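import Summits.AtomisticToContinuum.Crystallization.Theorems.FrustratedLawDichotomyCellF1Interior
import Summits.AtomisticToContinuum.Crystallization.Theorems.FrustratedLawDichotomyCellF1Lists

/-!
# FrustratedLawDichotomy · crux `AperiodicFrustratedLawGap` (stmt-AtomisticToContinuum-27623) — class-A K-file skeleton, layer 2g:
the F1 template column as a NAMED DEFINITION, with the layer 1–2e facts restated on it (decomp-a2c hand-2 g47, structural share;
KFILE-FORMAT ed2c §3″ RULE G5, lens-5 l.9589/AMEND 13:21Z, crit r1830: «in any call of a master whose `M` is the list-backed set, EVERY
function-valued DATA argument is a named `def` — never a `fun m => …` lambda (β-redexes in the kernel's re-inferred type make the conversion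
check unfold the 14k-label set: excessive memory at ≈ 125 s; named columns: 4 s)»)

`aF1 m := T · z m` (the `a`/`pos` data argument of (251) `lb_le_certFloorL_trunc`, hand-1 `lb_le_certFloorL_scale`, (260) `rowFloor_of_nearIdBox`,
(272) `nn_of_reps` for the F1 cell) and `zeroF1 := 0` (the empty multiplier column outside `MI`, TOY 9's `Y0`).  Every F1 fact of layers 1–2e that a
master consumes is restated VERBATIM on `aF1` (each proof is the original term — `aF1 m` is definitionally the old explicit column): root, `Stab16`
equivariance, template scalar, separation, window / interior, norm bounds, window completeness, the mirror `hnbh`, far conversions.  The Floor/Near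
files pass `aF1` (and their own named reading columns) and these theorems, and nothing β-reduces in the kernel.
-/

namespace Summit.AtomisticToContinuum.Crystallization.Theorems.FrustratedLawDichotomyCellF1Pos

open scoped BigOperators
open Summit.AtomisticToContinuum.Crystallization.Theorems.FrustratedLawDichotomyCellMetric (posL)
open Summit.AtomisticToContinuum.Crystallization.Theorems.FrustratedLawDichotomyCellClasses (ballL)
open Summit.AtomisticToContinuum.Crystallization.Theorems.FrustratedLawDichotomyCellTriples (zT sumT)
open Summit.AtomisticToContinuum.Crystallization.Theorems.FrustratedLawDichotomyCellHostMirror (mirrorNbh mirT)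
open Summit.AtomisticToContinuum.Crystallization.Theorems.FrustratedLawDichotomyCellSymmZ3 (actZ)
open Summit.AtomisticToContinuum.Crystallization.Theorems.FrustratedLawDichotomyCellStab16 (RZ Rr)
open Summit.AtomisticToContinuum.Crystallization.Theorems.FrustratedLawDichotomyCellF1Frame (T qk a_root a_act sumSq_T)
open Summit.AtomisticToContinuum.Crystallization.Theorems.FrustratedLawDichotomyCellF1Labels (MF1 MIF1 hsep hwin hint)
open Summit.AtomisticToContinuum.Crystallization.Theorems.FrustratedLawDichotomyCellF1Host (RwF1 hout_F1 hnbh_F1)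
open Summit.AtomisticToContinuum.Crystallization.Theorems.FrustratedLawDichotomyCellF1Interior
  (norm_MI_le norm_M_le norm_M_add_tau_le hnbh_F1_const)
open Summit.AtomisticToContinuum.Crystallization.Theorems.FrustratedLawDichotomyCellF1Lists (far_of_not_mem_ballF1 dist_of_not_mem_ballF1)

/-- ★ the F1 template column, NAMED (rule G5): `aF1 m = T · z m`. -/
noncomputable def aF1 (m : ℤ × ℤ × ℤ) : Fin 3 → ℝ := T.mulVec fun j => (zT m j : ℝ)

/-- the empty multiplier column (labels outside the interior carry no multiplier), NAMED (rule G5). -/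
def zeroF1 (_ : ℤ × ℤ × ℤ) : Fin 3 → ℝ := 0

/-- unfolding of the column (definitional). -/
theorem aF1_eq (m : ℤ × ℤ × ℤ) : aF1 m = T.mulVec fun j => (zT m j : ℝ) := rfl

/-- unfolding of the empty column. -/
theorem zeroF1_eq (m : ℤ × ℤ × ℤ) : zeroF1 m = 0 := rfl

/-- the root sits at the origin. -/
theorem aF1_root : aF1 (0 : ℤ × ℤ × ℤ) = 0 := a_root

/-- `Stab16` equivariance of the column (the `ha` binder of (272)). -/
theorem aF1_act (k : Fin 16) (x : ℤ × ℤ × ℤ) : aF1 (actZ (RZ k) x) = (Rr k).mulVec (aF1 x) := a_act k x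

/-- the `ha` binder of (272) `nn_of_reps` on `MF1`, verbatim. -/
theorem ha_aF1 : ∀ k : Fin 16, ∀ x ∈ MF1, aF1 (actZ (RZ k) x) = (Rr k).mulVec (aF1 x) := fun k x _ => a_act k x

/-- the template scalar: `Σᵢ (aF1 m)ᵢ² = qk m / 16384²`. -/
theorem sumSq_aF1 (m : ℤ × ℤ × ℤ) : ∑ i, aF1 m i ^ 2 = (qk m : ℝ) / 16384 ^ 2 := sumSq_T m

/-- ★ (hsep) `7/10`-separation of the strained column on `MF1`, every `F` of the cell. -/
theorem hsep_aF1 {F : Matrix (Fin 3) (Fin 3) ℝ} (hG : ∀ i j, |(F.transpose * F) i j - (if i = j then 1 else 0)| ≤ 1 / 1024) :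
    ∀ z ∈ MF1, ∀ z' ∈ MF1, z ≠ z' → (7 / 10 : ℝ) ≤ dist (posL F (aF1 z)) (posL F (aF1 z')) := hsep hG

/-- (hwin / hin) the window row `(1 + 3ε)·Σᵢ(aF1 m)ᵢ² ≤ (Rc − τ)²` on `MF1`. -/
theorem hwin_aF1 : ∀ m ∈ MF1, (1 + 3 * (1 / 1024 : ℝ)) * ∑ i, aF1 m i ^ 2 ≤ (13 - 1 / 1024) ^ 2 := hwin

/-- the interior row `(1 + 3ε)·Σᵢ(aF1 m)ᵢ² ≤ R_A²` on `MIF1`. -/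
theorem hint_aF1 : ∀ m ∈ MIF1, (1 + 3 * (1 / 1024 : ℝ)) * ∑ i, aF1 m i ^ 2 ≤ 4 ^ 2 := hint

/-- interior labels within `4` of the root. -/
theorem norm_MI_le_aF1 {F : Matrix (Fin 3) (Fin 3) ℝ} (hG : ∀ i j, |(F.transpose * F) i j - (if i = j then 1 else 0)| ≤ 1 / 1024) :
    ∀ m ∈ MIF1, ‖posL F (aF1 m)‖ ≤ 4 := norm_MI_le hG

/-- every label within `Rc − τ` of the root. -/
theorem norm_M_le_aF1 {F : Matrix (Fin 3) (Fin 3) ℝ} (hG : ∀ i j, |(F.transpose * F) i j - (if i = j then 1 else 0)| ≤ 1 / 1024) :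
    ∀ m ∈ MF1, ‖posL F (aF1 m)‖ ≤ 13 - 1 / 1024 := norm_M_le hG

/-- the doors' window hypothesis `‖pos m‖ + τ ≤ Rc`. -/
theorem norm_M_add_tau_le_aF1 {F : Matrix (Fin 3) (Fin 3) ℝ} (hG : ∀ i j, |(F.transpose * F) i j - (if i = j then 1 else 0)| ≤ 1 / 1024) :
    ∀ m ∈ MF1, ‖posL F (aF1 m)‖ + 1 / 1024 ≤ 13 := norm_M_add_tau_le hG

/-- ★ (hout) window completeness at radius `RwF1 = 13271/1024`. -/
theorem hout_aF1 {F : Matrix (Fin 3) (Fin 3) ℝ} (hG : ∀ i j, |(F.transpose * F) i j - (if i = j then 1 else 0)| ≤ 1 / 1024) :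
    ∀ x : ℤ × ℤ × ℤ, Even (sumT x) → x ∉ MF1 → RwF1 ≤ ‖posL F (aF1 x)‖ := hout_F1 hG

/-- ★ (hnbh) the mirror-host side condition with a per-label dial `Lh`, `Lh m + ‖pos m‖ ≤ RwF1`. -/
theorem hnbh_aF1 {F : Matrix (Fin 3) (Fin 3) ℝ} (hG : ∀ i j, |(F.transpose * F) i j - (if i = j then 1 else 0)| ≤ 1 / 1024)
    {Lh : ℤ × ℤ × ℤ → ℝ} (hLw : ∀ m ∈ MIF1, Lh m + ‖posL F (aF1 m)‖ ≤ RwF1) :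
    ∀ m ∈ MIF1, ∀ m' ∈ MF1, m' ≠ m → m' ∉ mirrorNbh MF1 mirT m → Lh m ≤ dist (posL F (aF1 m')) (posL F (aF1 m)) := hnbh_F1 hG hLw

/-- (hnbh) with a constant dial `L ≤ RwF1 − 4`. -/
theorem hnbh_aF1_const {F : Matrix (Fin 3) (Fin 3) ℝ} (hG : ∀ i j, |(F.transpose * F) i j - (if i = j then 1 else 0)| ≤ 1 / 1024)
    {L : ℝ} (hL : L ≤ RwF1 - 4) :
    ∀ m ∈ MIF1, ∀ m' ∈ MF1, m' ≠ m → m' ∉ mirrorNbh MF1 mirT m → L ≤ dist (posL F (aF1 m')) (posL F (aF1 m)) := hnbh_F1_const hG hL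

/-- ★ far conversion about the root: outside the `ℓ`-ball ⇒ `L ≤ ‖pos m‖` whenever `L² ≤ (1 − 3ε)(2/5)ℓ` (the `hMNc`/`hMLc`/`hfarL` inputs). -/
theorem far_aF1 {F : Matrix (Fin 3) (Fin 3) ℝ} (hG : ∀ i j, |(F.transpose * F) i j - (if i = j then 1 else 0)| ≤ 1 / 1024)
    {L : ℝ} {ℓ : ℤ} (hL : L ^ 2 ≤ (1 - 3 * (1 / 1024)) * (2 / 5) * ℓ) {m : ℤ × ℤ × ℤ} (hm : m ∈ MF1)
    (hn : m ∉ ballL MF1 zT ℓ (0 : ℤ × ℤ × ℤ)) : L ≤ ‖posL F (aF1 m)‖ := far_of_not_mem_ballF1 hG hL hm hn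

/-- far conversion about any label `c` (the `nb`/`nbr` inputs). -/
theorem dist_aF1 {F : Matrix (Fin 3) (Fin 3) ℝ} (hG : ∀ i j, |(F.transpose * F) i j - (if i = j then 1 else 0)| ≤ 1 / 1024)
    {L : ℝ} {ℓ : ℤ} (hL : L ^ 2 ≤ (1 - 3 * (1 / 1024)) * (2 / 5) * ℓ) {c m : ℤ × ℤ × ℤ} (hm : m ∈ MF1) (hn : m ∉ ballL MF1 zT ℓ c) :
    L ≤ dist (posL F (aF1 m)) (posL F (aF1 c)) := dist_of_not_mem_ballF1 hG hL hm hn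

end Summit.AtomisticToContinuum.Crystallization.Theorems.FrustratedLawDichotomyCellF1Pos
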